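import Mathlib
import Summits.ResolutionOfSingularities.ResolutionOfSingularities.Theorems.HomologicalConductorPersistenceFrobeniusDifferent
import Summits.ResolutionOfSingularities.ResolutionOfSingularities.Theorems.HomologicalConductorPersistenceBezoutian
import HarnessLib

/-!
# Rung S-2 `PersistenceSurface` (stmt-19970), crux `Persistence` (16484) — JACOBIAN DETERMINANTS LIE IN THE
# NOETHER DIFFERENT, hence in `caᵈ⁺¹` over a projective Noether normalisation (the «F-new-CI» floor for
# complete intersections, chain W4.4b, seat res-L1-w44b-stub-4 gen 5)

[OURS · L1 w44b · rung S-2] Nothing here is a statement of the manuscript under review (Hironaka 2017);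
AI-written, weaker than expert review.

WHY. The S-2 floors at the complete-intersection UAC covers (W12 `V(5,5,2,2)`, E14 `V(2,3,3,4)`, Z13
`V(2,3,3,6)`, W13 `V(2,4,4,4)`; CHAIN v13.6–v13.9, R14 premise (α)) feed the 2 × 2 Jacobian minors
`Δ_{kl} = ∂(f₁,f₂)/∂(z_k,z_l)` of the codimension-2 complete intersection `V = k[z₁,…,z₄]/(f₁,f₂)` into the
transfer lemmas as elements of `ca³(V)` — premise «F-new-CI» (Jacobian of an isolated complete intersection
`⊆ ca`, print only: Iyengar–Takahashi 2021).  This file proves the algebraic heart in the kernel, basis-free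
and for any square system:

* `exists_dividedDifferences` — for `F ∈ A[X₁,…,X_n]` there are `G_j ∈ A[X″,X′]` with
  `F(X″) − F(X′) = Σ_j (X″_j − X′_j) G_j` and `G_j(X,X) = ∂F/∂X_j` (induction on `F`).
* **`det_jacobian_mem_noetherDifferent`** — if `x₁,…,x_n` generate the `A`-algebra `B` and
  `F₁,…,F_n ∈ A[X]` vanish at `x`, then `det(∂F_i/∂X_j (x)) ∈ 𝔑(B/A)`: the matrix
  `Δ = (G_{ij}(x ⊗ 1, 1 ⊗ x))` is a BEZOUTIAN in the sense of the tree's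
  `PersistenceBezoutian.det_map_lmul_mem_noetherDifferent` (res-L1-w44b-stub-3; Cramer in `B ⊗_A B`, which we
  REUSE — that file deliberately left the construction of divided differences to the user; this file supplies it),
  and `μ(Δ_{ij}) = ∂F_i/∂X_j(x)`.  No flatness / complete-intersection hypothesis is needed for the MEMBERSHIP
  (E. Kunz, *Kähler Differentials*, §10 / Scheja–Storch: for a finite flat complete intersection `𝔑 = (det)`).
* **`det_jacobian_mem_cohomologyAnnihilatorOfDegree`** — with `B` module-finite projective over a noetherian
  `A` with `caᵈ⁺¹(A) = A` (tree `noetherDifferent_le_cohomologyAnnihilatorOfDegree_of_projective`, idea-2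
  p532326): `det(∂F_i/∂X_j(x)) ∈ caᵈ⁺¹(B)`; `…_mvPolynomial` for `A = k[θ₁,…,θ_d]`.

USE (S-2): `V = k[z₁,…,z₄]/(f₁,f₂)` graded Cohen–Macaulay is free over `A = k[z_i,z_j]` whenever
`V/(z_i,z_j)` is finite; `B := V` is generated over `A` by `z_k, z_l`, `F = (f₁,f₂) ∈ A[Z_k,Z_l]` vanish, so
`Δ_{kl} ∈ 𝔑(V/A) ⊆ ca³(V)`.  For the four BP complete intersections above all six coordinate pairs are
parameters, so `J(V) = (Δ_{kl})` IS a kernel floor modulo the (numerically verified) freeness of `V` over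
each `k[z_i,z_j]`.

References: E. Kunz, *Kähler Differentials* (Vieweg 1986), §10; G. Scheja, U. Storch, *Über
Spurfunktionen bei vollständigen Durchschnitten*, J. reine angew. Math. 278/279 (1975); S. B. Iyengar,
R. Takahashi, arXiv:1404.1476 Prop. 3.4 [`IyengarTakahashi2014`].  All `[folklore]` at the level used here.
-/

-- single-problem summit: the doubled namespace component `ResolutionOfSingularities` is forced
set_option linter.dupNamespace false

noncomputable section

open Literature.RingTheory.CohomologyAnnihilator
open Summit.ResolutionOfSingularities.ResolutionOfSingularities.Theorems.HomologicalConductor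
open scoped TensorProduct
open MvPolynomial

universe u

namespace Summit.ResolutionOfSingularities.ResolutionOfSingularities.Theorems.HomologicalConductor.PersistenceJacobianDifferent

variable {A : Type u} [CommRing A]

/-! ## Divided differences -/

/-- **Divided differences.**  For every `F ∈ A[X_σ]` (`σ` finite) there are `G_j ∈ A[X″, X′]` with
`F(X″) − F(X′) = Σ_j (X″_j − X′_j) · G_j` and `G_j(X, X) = ∂F/∂X_j`. [folklore] -/
theorem exists_dividedDifferences {σ : Type*} [Fintype σ] [DecidableEq σ] (F : MvPolynomial σ A) :
    ∃ G : σ → MvPolynomial (σ ⊕ σ) A,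
      rename Sum.inl F - rename Sum.inr F = ∑ j, (X (Sum.inl j) - X (Sum.inr j)) * G j ∧
      ∀ j, aeval (Sum.elim X X) (G j) = pderiv j F := by
  induction F using MvPolynomial.induction_on with
  | C a =>
    refine ⟨fun _ => 0, ?_, fun j => ?_⟩
    · simp
    · simp
  | add p q hp hq =>
    obtain ⟨G, hG, hG'⟩ := hp
    obtain ⟨H, hH, hH'⟩ := hq
    refine ⟨fun j => G j + H j, ?_, fun j => ?_⟩
    · rw [map_add, map_add, show ∑ j, (X (Sum.inl j) - X (Sum.inr j)) * (G j + H j) =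
          ∑ j, (X (Sum.inl j) - X (Sum.inr j)) * G j + ∑ j, (X (Sum.inl j) - X (Sum.inr j)) * H j by
        rw [← Finset.sum_add_distrib]; exact Finset.sum_congr rfl fun j _ => mul_add _ _ _, ← hG, ← hH]
      ring
    · rw [map_add, hG', hH', map_add]
  | mul_X p i hp =>
    obtain ⟨G, hG, hG'⟩ := hp
    refine ⟨fun j => G j * X (Sum.inl i) + (if j = i then rename Sum.inr p else 0), ?_, fun j => ?_⟩
    · have key : rename Sum.inl (p * X i) - rename Sum.inr (p * X i) =
          (rename Sum.inl p - rename Sum.inr p) * X (Sum.inl i) +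
            (X (Sum.inl i) - X (Sum.inr i)) * rename (Sum.inr) p := by
        simp only [map_mul, rename_X]
        ring
      rw [key, hG, Finset.sum_mul]
      rw [show ∑ j, (X (Sum.inl j) - X (Sum.inr j)) * (G j * X (Sum.inl i) + if j = i then rename Sum.inr p else 0)
          = ∑ j, ((X (Sum.inl j) - X (Sum.inr j)) * G j * X (Sum.inl i) +
              (X (Sum.inl j) - X (Sum.inr j)) * (if j = i then rename Sum.inr p else 0)) from
          Finset.sum_congr rfl fun j _ => by ring, Finset.sum_add_distrib]
      congr 1
      rw [Finset.sum_eq_single i (fun j _ hj => by rw [if_neg hj, mul_zero]) (fun h => absurd (Finset.mem_univ i) h),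
        if_pos rfl]
    · rw [map_add, map_mul, hG', pderiv_mul, pderiv_X]
      simp only [aeval_X, Sum.elim_inl, Pi.single_apply]
      by_cases h : j = i
      · subst h
        simp only [if_true]
        rw [aeval_rename]
        have : (aeval (Sum.elim X X ∘ Sum.inr) : MvPolynomial σ A →ₐ[A] MvPolynomial σ A) p = p := by
          have hcomp : (Sum.elim X X ∘ Sum.inr : σ → MvPolynomial σ A) = X := by funext s; rfl
          rw [hcomp, aeval_X_left, AlgHom.id_apply]
        rw [this, mul_one]
      · rw [if_neg h, if_neg (Ne.symm h), map_zero, add_zero, mul_zero, add_zero]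

/-! ## Jacobian determinants are in the noether different -/

section Different

variable {B : Type u} [CommRing B] [Algebra A B]

/-- **Jacobian determinants lie in the noether different.**  `x : Fin n → B` generators of the `A`-algebra
`B`, `F : Fin n → A[X₁,…,X_n]` with `F_i(x) = 0`; then `det (∂F_i/∂X_j (x))_{ij} ∈ 𝔑(B/A)`.
[folklore] (Kunz, *Kähler Differentials* §10; Scheja–Storch 1975) -/
theorem det_jacobian_mem_noetherDifferent {n : ℕ} (x : Fin n → B) (hx : Algebra.adjoin A (Set.range x) = ⊤)
    (F : Fin n → MvPolynomial (Fin n) A) (hF : ∀ i, aeval x (F i) = 0) :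
    (Matrix.of fun i j => aeval x (pderiv j (F i))).det ∈ noetherDifferent A B := by
  classical
  choose G hG hG' using fun i => exists_dividedDifferences (A := A) (F i)
  -- the two-sided evaluation `X″ ↦ x ⊗ 1`, `X′ ↦ 1 ⊗ x`
  let Ψ : MvPolynomial (Fin n ⊕ Fin n) A →ₐ[A] B ⊗[A] B :=
    aeval (Sum.elim (fun j => x j ⊗ₜ[A] (1 : B)) (fun j => (1 : B) ⊗ₜ[A] x j))
  have hΨl : ∀ P : MvPolynomial (Fin n) A, Ψ (rename Sum.inl P) = (aeval x P) ⊗ₜ[A] (1 : B) := by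
    intro P
    rw [aeval_rename]
    have h1 : (aeval (Sum.elim (fun j => x j ⊗ₜ[A] (1 : B)) (fun j => (1 : B) ⊗ₜ[A] x j) ∘ Sum.inl) :
        MvPolynomial (Fin n) A →ₐ[A] B ⊗[A] B) =
        (Algebra.TensorProduct.includeLeft : B →ₐ[A] B ⊗[A] B).comp (aeval x) := by
      apply MvPolynomial.algHom_ext
      intro j
      simp [Algebra.TensorProduct.includeLeft_apply]
    exact congrArg (fun φ : MvPolynomial (Fin n) A →ₐ[A] B ⊗[A] B => φ P) h1
  have hΨr : ∀ P : MvPolynomial (Fin n) A, Ψ (rename Sum.inr P) = (1 : B) ⊗ₜ[A] (aeval x P) := by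
    intro P
    rw [aeval_rename]
    have h1 : (aeval (Sum.elim (fun j => x j ⊗ₜ[A] (1 : B)) (fun j => (1 : B) ⊗ₜ[A] x j) ∘ Sum.inr) :
        MvPolynomial (Fin n) A →ₐ[A] B ⊗[A] B) =
        (Algebra.TensorProduct.includeRight : B →ₐ[A] B ⊗[A] B).comp (aeval x) := by
      apply MvPolynomial.algHom_ext
      intro j
      simp [Algebra.TensorProduct.includeRight_apply]
    exact congrArg (fun φ : MvPolynomial (Fin n) A →ₐ[A] B ⊗[A] B => φ P) h1
  have hΨX : ∀ j, Ψ (X (Sum.inl j)) = x j ⊗ₜ[A] (1 : B) := fun j => aeval_X _ _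
  have hΨX' : ∀ j, Ψ (X (Sum.inr j)) = (1 : B) ⊗ₜ[A] x j := fun j => aeval_X _ _
  -- the Bezoutian `Δ_{ij} = G_{ij}(x ⊗ 1, 1 ⊗ x)`
  let Δ : Matrix (Fin n) (Fin n) (B ⊗[A] B) := Matrix.of fun i j => Ψ (G i j)
  have hΔ : ∀ i, ∑ j, Δ i j * (x j ⊗ₜ[A] (1 : B) - (1 : B) ⊗ₜ[A] x j) = 0 := by
    intro i
    have h := congrArg Ψ (hG i)
    rw [map_sub, hΨl, hΨr, hF i, map_sum] at h
    simp only [TensorProduct.zero_tmul, TensorProduct.tmul_zero, sub_self, map_mul, map_sub, hΨX, hΨX'] at h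
    change ∑ j, Ψ (G i j) * (x j ⊗ₜ[A] (1 : B) - (1 : B) ⊗ₜ[A] x j) = 0
    rw [h]
    exact Finset.sum_congr rfl fun j _ => mul_comm _ _
  have hmain := PersistenceBezoutian.det_map_lmul_mem_noetherDifferent x hx Δ hΔ
  -- `μ(Δ_{ij}) = ∂F_i/∂X_j (x)`
  have hμΨ : (Algebra.TensorProduct.lmul' (S := B) A).comp Ψ = (aeval x).comp (aeval (Sum.elim X X)) := by
    apply MvPolynomial.algHom_ext
    rintro (j | j) <;> simp [Ψ]
  have heq : Δ.map (Algebra.TensorProduct.lmul' (S := B) A) = Matrix.of fun i j => aeval x (pderiv j (F i)) := by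
    ext i j
    rw [Matrix.map_apply, Matrix.of_apply]
    change Algebra.TensorProduct.lmul' (S := B) A (Ψ (G i j)) = _
    have := congrArg (fun φ : MvPolynomial (Fin n ⊕ Fin n) A →ₐ[A] B => φ (G i j)) hμΨ
    simp only [AlgHom.comp_apply] at this
    rw [this, hG']
  rwa [heq] at hmain

/-- **Jacobian determinants are cohomology annihilators over a projective base.**  `B` module-finite and
projective over the noetherian ring `A` with `caᵈ⁺¹(A) = A`, `x` algebra generators, `F_i(x) = 0`
(`i, j < n`): `det(∂F_i/∂X_j(x)) ∈ caᵈ⁺¹(B)`. [OURS · L1 w44b] -/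
theorem det_jacobian_mem_cohomologyAnnihilatorOfDegree [IsNoetherianRing A] [Module.Finite A B]
    [Module.Projective A B] {d : ℕ} (hvan : cohomologyAnnihilatorOfDegree A (d + 1) = ⊤) {n : ℕ}
    (x : Fin n → B) (hx : Algebra.adjoin A (Set.range x) = ⊤) (F : Fin n → MvPolynomial (Fin n) A)
    (hF : ∀ i, aeval x (F i) = 0) :
    (Matrix.of fun i j => aeval x (pderiv j (F i))).det ∈ cohomologyAnnihilatorOfDegree B (d + 1) :=
  PersistenceFrobeniusDifferent.noetherDifferent_le_cohomologyAnnihilatorOfDegree_of_projective hvan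
    (det_jacobian_mem_noetherDifferent x hx F hF)

end Different

/-- **The complete-intersection floor over a polynomial Noether normalisation.**  `B` module-finite and
projective over `k[θ₁,…,θ_d]` (e.g. a graded Cohen–Macaulay ring over a homogeneous system of parameters),
generated by `x₁,…,x_n` with `F_i(x) = 0` for `n` polynomials `F_i ∈ k[θ][X₁,…,X_n]`: then
`det(∂F_i/∂X_j(x)) ∈ caᵈ⁺¹(B)` — for a codimension-`c` complete intersection `k[z]/(f₁,…,f_c)` finite free
over the coordinates `z_S` (`|S| = d`) this is the maximal Jacobian minor in the complementary columns.
[OURS · L1 w44b] -/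
theorem det_jacobian_mem_cohomologyAnnihilatorOfDegree_mvPolynomial (k : Type u) [Field k] (d : ℕ)
    {B : Type u} [CommRing B] [Algebra (MvPolynomial (Fin d) k) B]
    [Module.Finite (MvPolynomial (Fin d) k) B] [Module.Projective (MvPolynomial (Fin d) k) B] {n : ℕ}
    (x : Fin n → B) (hx : Algebra.adjoin (MvPolynomial (Fin d) k) (Set.range x) = ⊤)
    (F : Fin n → MvPolynomial (Fin n) (MvPolynomial (Fin d) k)) (hF : ∀ i, aeval x (F i) = 0) :
    (Matrix.of fun i j => aeval x (pderiv j (F i))).det ∈ cohomologyAnnihilatorOfDegree B (d + 1) :=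
  PersistenceFrobeniusDifferent.noetherDifferent_mvPolynomial_le_cohomologyAnnihilatorOfDegree k d
    (det_jacobian_mem_noetherDifferent x hx F hF)

end Summit.ResolutionOfSingularities.ResolutionOfSingularities.Theorems.HomologicalConductor.PersistenceJacobianDifferent

end
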